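import Literature.Probability.Percolation.MarkedLoopTemperleyLiebPeriodic
import Mathlib.LinearAlgebra.Dual.Defs
import HarnessLib

/-!
# The tripod-law solution space IS the dual of the planar Temperley–Lieb module, the mark rotation being the transpose of Kauffman's generator («TRIPOD-TL-DUAL»)

Topic `Literature/Probability/Percolation`; a rider on `MarkedLoopTemperleyLiebPeriodic.lean` («TL-PERIODIC-LINK»: `tlBmod = kauffmanGen (tlLper 1) (−τ) (−τ²) (last) * lpRotL`
— Kauffman's generator at the closing edge `{*, 0}` after the polygon rotation, on the planar module `LinkPattern (k+1) →₀ ℂ` —, `linearCombination_tlBraid`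
(⟪tlBraid φ, x⟫ = ⟪φ, tlBmod x⟫), `tlBmodInv`, `tlBraidInv_eq_linearCombination_tlBmodInv`) and on `MarkedLoopTemperleyLiebCoords.lean` (`solWLinkEquiv : solW k ≃ₗ
(LinkPattern (k+1) → ℂ)`, `solWLinkEquiv_solWRot`, `solWLinkEquiv_solWRot_symm`). It states the lane's dictionary in its final, one-line form:

* `funEquivDual` — functions on link patterns ≃ₗ the DUAL of the planar module (Mathlib's `Finsupp.llift`), `funEquivDual_apply` (= `Finsupp.linearCombination`);
* ★ `solWDualEquiv k : solW k ≃ₗ[ℂ] Module.Dual ℂ (LinkPattern (k+1) →₀ ℂ)` — **KHRISTOFOROV–SMIRNOV'S TRIPOD-LAW SOLUTION SPACE IS THE DUAL OF PEARCE–RITTENBERG–DE GIER–NIENHUIS'S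
  PLANAR TEMPERLEY–LIEB MODULE** of the `(k+1)`-gon;
* ★★★ `solWDualEquiv_solWRot` — **UNDER IT, THE RELABELLING ROTATION OF THE `k` MARKS IS THE TRANSPOSE (`Module.Dual.transpose` / `LinearMap.dualMap`) OF `tlBmod`**, Kauffman's
  `σ ↦ A⁻¹ + A·U` at the closing edge composed with the polygon rotation (`A = −τ²`): `solWDualEquiv (rot·w) = tlBmod.dualMap (solWDualEquiv w)`;
  ★★ `solWDualEquiv_solWRot_symm` — and the inverse rotation is the transpose of `tlBmodInv` (`A·1 + A⁻¹·e_{k−1,*}` after `ρ⁻¹`);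
  `solWDualEquiv_rotOp` — all powers: `R_m` is the transpose of `tlBmod ^ m`.

## References
* M. Khristoforov, S. Smirnov, *Percolation and O(1) loop model*, arXiv:2111.15612 (2021), §1.2 (arXiv v1 p. 2: cyclic indexing of the marks), §2 Lemma 4 (p. 4).
* P. A. Pearce, V. Rittenberg, J. de Gier, B. Nienhuis, J. Phys. A 35 (2002) L661–L668, §2 (the link-pattern module).
* L. H. Kauffman, *Knots and Physics* (1991), Part I §7 (`ρ(σᵢ) = A + A⁻¹Uᵢ`, Prop. 7.5).

## Mathlib / tree
Tree: `MarkedLoopTemperleyLiebPeriodic.lean` (`tlBmod`, `tlBmodInv`, `linearCombination_tlBraid`, `tlBraid_pow_eq_linearCombination`, `tlBraidInv_eq_linearCombination_tlBmodInv`),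
`MarkedLoopTemperleyLiebCoords.lean` (`solWLinkEquiv`, `solWLinkEquiv_solWRot`, `solWLinkEquiv_solWRot_symm`, `tlBraid_pow`, `rotOp`). Mathlib: `Finsupp.llift`, `Finsupp.lift_apply`,
`Finsupp.linearCombination_apply`, `LinearMap.dualMap_apply`.
-/

namespace Literature.Probability.Percolation.MarkedLoops

open Literature.Probability.Percolation.FivePoint (tau)
open Literature.Probability.LatticeModels.TemperleyLieb

section Dual

variable {n : ℕ}

/-- **functions on link patterns are the dual of the planar module** (`φ ↦ ⟪φ, ·⟫ = Σ_Q x(Q)·φ(Q)`; Mathlib's `Finsupp.llift`).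
[cite: PearceRittenbergDeGierNienhuis2002, §2 (the link-pattern module)] -/
noncomputable def funEquivDual : (LinkPattern (n + 1 + 1) → ℂ) ≃ₗ[ℂ] Module.Dual ℂ (LinkPattern (n + 1 + 1) →₀ ℂ) :=
  Finsupp.llift ℂ ℂ ℂ (LinkPattern (n + 1 + 1))

/-- the pairing is the linear combination `⟪φ, x⟫`. [cite: PearceRittenbergDeGierNienhuis2002, §2] -/
theorem funEquivDual_apply (φ : LinkPattern (n + 1 + 1) → ℂ) (x : LinkPattern (n + 1 + 1) →₀ ℂ) :
    funEquivDual φ x = Finsupp.linearCombination ℂ φ x := by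
  rw [funEquivDual, Finsupp.llift_apply, Finsupp.lift_apply, Finsupp.linearCombination_apply]

/-- ★ **THE TRIPOD-LAW SOLUTION SPACE IS THE DUAL OF THE PLANAR TEMPERLEY–LIEB MODULE OF THE `(k+1)`-GON** (`k = n+1` marks): `solWLinkEquiv` followed by `funEquivDual`.
[cite: KhristoforovSmirnov2021, §2 Lemma 4 (arXiv v1 p. 4); PearceRittenbergDeGierNienhuis2002, §2 (the link-pattern module)] -/
noncomputable def solWDualEquiv (n : ℕ) : solW (n + 1) ≃ₗ[ℂ] Module.Dual ℂ (LinkPattern (n + 1 + 1) →₀ ℂ) :=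
  (solWLinkEquiv (n + 1)).trans funEquivDual

/-- the dual vector of `w` evaluated: `⟪solWLinkEquiv w, x⟫`. [cite: KhristoforovSmirnov2021, §2 Lemma 4 (arXiv v1 p. 4)] -/
theorem solWDualEquiv_apply (w : solW (n + 1)) (x : LinkPattern (n + 1 + 1) →₀ ℂ) :
    solWDualEquiv n w x = Finsupp.linearCombination ℂ (solWLinkEquiv (n + 1) w) x := by
  rw [solWDualEquiv, LinearEquiv.trans_apply, funEquivDual_apply]

/-- ★★★ **THE RELABELLING ROTATION OF KHRISTOFOROV–SMIRNOV'S MARKS IS THE TRANSPOSE OF KAUFFMAN'S GENERATOR AT THE CLOSING EDGE AFTER THE POLYGON ROTATION**: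
`solWDualEquiv (rot·w) = tlBmod.dualMap (solWDualEquiv w)`, where `tlBmod = kauffmanGen (tlLper 1) (−τ) (−τ²) (last) * lpRotL` on the planar module.
[cite: KhristoforovSmirnov2021, §2 Lemma 4, proof and Fig. 3 (arXiv v1 p. 4); §1.2 (p. 2); Kauffman1991KnotsPhysics, Part I §7: ρ(σᵢ) = A + A⁻¹Uᵢ, Prop. 7.5; PearceRittenbergDeGierNienhuis2002, §2] -/
theorem solWDualEquiv_solWRot (w : solW (n + 1)) :
    solWDualEquiv n (solWRot (n + 1) (rot (n + 1)) isCyc_rot w) = (tlBmod : Module.End ℂ (LinkPattern (n + 1 + 1) →₀ ℂ)).dualMap (solWDualEquiv n w) := by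
  apply LinearMap.ext
  intro x
  rw [LinearMap.dualMap_apply, solWDualEquiv_apply, solWDualEquiv_apply, solWLinkEquiv_solWRot, linearCombination_tlBraid]

/-- ★★ **THE INVERSE ROTATION IS THE TRANSPOSE OF THE INVERSE GENERATOR** `tlBmodInv = kauffmanGen (tlLper 1) (−τ²) (−τ) (k−1) * lpRotInvL`.
[cite: KhristoforovSmirnov2021, §2 Lemma 4 (arXiv v1 p. 4); Kauffman1991KnotsPhysics, Part I §7: ρ(σᵢ⁻¹) = A⁻¹ + AUᵢ, Prop. 7.5] -/
theorem solWDualEquiv_solWRot_symm (w : solW (n + 1)) :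
    solWDualEquiv n ((solWRot (n + 1) (rot (n + 1)) isCyc_rot).symm w) =
      (tlBmodInv : Module.End ℂ (LinkPattern (n + 1 + 1) →₀ ℂ)).dualMap (solWDualEquiv n w) := by
  apply LinearMap.ext
  intro x
  rw [LinearMap.dualMap_apply, solWDualEquiv_apply, solWDualEquiv_apply, solWLinkEquiv_solWRot_symm]
  -- transposition of the inverse, extended linearly from basis vectors
  have h : (Finsupp.linearCombination ℂ (tlBraidInv (solWLinkEquiv (n + 1) w)) : (LinkPattern (n + 1 + 1) →₀ ℂ) →ₗ[ℂ] ℂ) =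
      Finsupp.linearCombination ℂ (solWLinkEquiv (n + 1) w) ∘ₗ (tlBmodInv : Module.End ℂ (LinkPattern (n + 1 + 1) →₀ ℂ)) := by
    refine Finsupp.lhom_ext fun P c => ?_
    rw [LinearMap.comp_apply, ← mul_one c, ← smul_eq_mul, ← Finsupp.smul_single, map_smul, map_smul, map_smul, Finsupp.linearCombination_single, one_smul,
      tlBraidInv_eq_linearCombination_tlBmodInv]
  exact LinearMap.congr_fun h x

/-- ★★ **ALL POWERS: the `m`-fold mark rotation `R_m` is the transpose of `tlBmod ^ m`.** [cite: KhristoforovSmirnov2021, §1.2 (arXiv v1 p. 2: cyclic indexing); Kauffman1991KnotsPhysics, Part I §7 Prop. 7.5] -/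
theorem solWDualEquiv_rotOp (m : ℕ) (w : solW (n + 1)) :
    solWDualEquiv n (rotOp (n + 1) m w) = ((tlBmod : Module.End ℂ (LinkPattern (n + 1 + 1) →₀ ℂ)) ^ m).dualMap (solWDualEquiv n w) := by
  apply LinearMap.ext
  intro x
  rw [LinearMap.dualMap_apply, solWDualEquiv_apply, solWDualEquiv_apply]
  have hrot : solWLinkEquiv (n + 1) (rotOp (n + 1) m w) = ((tlBraid : Module.End ℂ (LinkPattern (n + 1 + 1) → ℂ)) ^ m) (solWLinkEquiv (n + 1) w) := by
    rw [tlBraid_pow, LinearEquiv.conj_apply_apply, LinearEquiv.symm_apply_apply]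
  rw [hrot]
  have h : (Finsupp.linearCombination ℂ (((tlBraid : Module.End ℂ (LinkPattern (n + 1 + 1) → ℂ)) ^ m) (solWLinkEquiv (n + 1) w)) : (LinkPattern (n + 1 + 1) →₀ ℂ) →ₗ[ℂ] ℂ) =
      Finsupp.linearCombination ℂ (solWLinkEquiv (n + 1) w) ∘ₗ ((tlBmod : Module.End ℂ (LinkPattern (n + 1 + 1) →₀ ℂ)) ^ m) := by
    refine Finsupp.lhom_ext fun P c => ?_
    rw [LinearMap.comp_apply, ← mul_one c, ← smul_eq_mul, ← Finsupp.smul_single, map_smul, map_smul, map_smul, Finsupp.linearCombination_single, one_smul,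
      tlBraid_pow_eq_linearCombination]
  exact LinearMap.congr_fun h x

/-- the dimension statement in dual form: `dim solW k = dim (planar module) = #LinkPattern (k+1)`. [cite: KhristoforovSmirnov2021, §2 Lemma 4 (arXiv v1 p. 4); PearceRittenbergDeGierNienhuis2002, §2 (`C_{L,m}`)] -/
theorem finrank_solW_eq_finrank_linkModule :
    Module.finrank ℂ (solW (n + 1)) = Module.finrank ℂ (LinkPattern (n + 1 + 1) →₀ ℂ) := by
  rw [finrank_solW_eq_card_linkPattern, Module.finrank_finsupp_self]

end Dual

end Literature.Probability.Percolation.MarkedLoops
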